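import Summits.Schanuel.Schanuel.Theorems.ZilberEacGraphReciprocalQuadratic
import HarnessLib

/-!
# The equimodular class, XXXVII: the discriminant of an irreducible quadratic fibre is not a square —
# the quadratic theorem without small print

HONEST FRAMING.  Cell `pub-schanuel` (Zilber's Exponential-Algebraic Closedness, case ladder;
host summit Schanuel), seat 2, gen 24.  Two pieces of algebra remove the last side condition of file
XXXV's unified quadratic theorem: **`disc_ne_sq_of_irreducible`** — if `P(x₀, y₀) = q₂y₀² + q₁y₀ + q₀`
is irreducible with `q₂ ≠ 0`, then `q₁² - 4q₂q₀ ≠ R²` for every `R ∈ ℂ[x₀]` (else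
`4q₂P = (2q₂y₀ + q₁ - R)(2q₂y₀ + q₁ + R)` and the prime `P`, of `y₀`-degree `2`, would divide a factor
of `y₀`-degree `1`); **`exists_odd_rootMultiplicity_of_ne_sq`** — a polynomial of positive degree that
is not a square has a root of odd multiplicity (`ℂ` algebraically closed).  Hence
**`unprojectedDense_graph_quadraticFibre'`**: EVERY irreducible quadratic fibre
`q₂(x₀)y₀² + q₁(x₀)y₀ + q₀(x₀)` whose top row `[x₀^N]q₂X² + [x₀^N]q₁X + [x₀^N]q₀` is separable with
nonzero extreme coefficients gives, over every polynomial graph `x₁ = p(x₀)` of degree `≥ 2`, a surface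
with Zariski-dense exponential points.  What remains in `y₀`-degree `2` over polynomial graphs: top
rows with a double root (ramified branches) and top rows missing `y₀²` or `y₀⁰` (gens 17–18 decide
those by growth).  An OPEN question in general (Mantova–Masser, PLMS 2024 §1 p. 5); EC(3,2) OPEN; NOT
Schanuel's conjecture (neither used nor implied; EAC ⇏ SC).
-/

noncomputable section

open Complex MvPolynomial
open Literature.NumberTheory.Transcendental Literature.ModelTheory.Zilber
open Literature.ModelTheory.ExponentialFields

set_option linter.dupNamespace false

namespace Summit.Schanuel.Schanuel.Theorems

/-! ## Part A. A non-square polynomial of positive degree has a root of odd multiplicity -/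

/-- **A polynomial over `ℂ` of positive degree all of whose roots have even multiplicity is a
square.** [folklore] -/
theorem exists_odd_rootMultiplicity_of_ne_sq {D : Polynomial ℂ} (hdeg : 0 < D.natDegree)
    (hne : ∀ R : Polynomial ℂ, D ≠ R ^ 2) : ∃ e : ℂ, Odd (Polynomial.rootMultiplicity e D) := by
  classical
  by_contra hall
  push Not at hall
  have hD0 : D ≠ 0 := by intro h; rw [h, Polynomial.natDegree_zero] at hdeg; exact lt_irrefl _ hdeg
  -- halve the multiplicities
  have heven : ∀ e, ∃ k, Polynomial.rootMultiplicity e D = 2 * k := fun e => by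
    have h := hall e
    rw [Nat.not_odd_iff_even] at h
    obtain ⟨k, hk⟩ := h
    exact ⟨k, by omega⟩
  choose k hk using heven
  obtain ⟨μ, hμ⟩ := IsAlgClosed.exists_pow_nat_eq D.leadingCoeff two_pos
  have hsplit := Polynomial.C_leadingCoeff_mul_prod_multiset_X_sub_C
    ((IsAlgClosed.splits D).natDegree_eq_card_roots).symm
  set R : Polynomial ℂ := Polynomial.C μ * ∏ e ∈ D.roots.toFinset, (Polynomial.X - Polynomial.C e) ^ k e
    with hR
  refine hne R ?_
  rw [hR, mul_pow, ← map_pow, hμ, ← Finset.prod_pow]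
  conv_lhs => rw [← hsplit, Finset.prod_multiset_map_count]
  congr 1
  refine Finset.prod_congr rfl fun e _ => ?_
  rw [← pow_mul, Polynomial.count_roots, hk e, mul_comm]

/-! ## Part B. The discriminant of an irreducible quadratic fibre is not a square -/

/-- Evaluation of `aeval (X 0) q` in one variable. [folklore] -/
theorem mvEval_aeval_X_fin_one (q : Polynomial ℂ) (t : ℂ) :
    MvPolynomial.eval (fun _ => t) (Polynomial.aeval (X 0 : MvPolynomial (Fin 1) ℂ) q) = q.eval t := by
  induction q using Polynomial.induction_on' with
  | add p r hp hr => simp only [map_add, Polynomial.eval_add, hp, hr]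
  | monomial n a =>
    simp only [Polynomial.aeval_monomial, MvPolynomial.algebraMap_eq, map_mul, map_pow,
      MvPolynomial.eval_C, MvPolynomial.eval_X, Polynomial.eval_monomial]

/-- `aeval (X 0)` into `MvPolynomial (Fin 1) ℂ` is injective. [folklore] -/
theorem aeval_X_fin_one_ne_zero {q : Polynomial ℂ} (hq : q ≠ 0) :
    Polynomial.aeval (X 0 : MvPolynomial (Fin 1) ℂ) q ≠ 0 := by
  intro h
  apply hq
  refine Polynomial.funext fun t => ?_
  have := congrArg (MvPolynomial.eval fun _ => t) h
  rw [mvEval_aeval_X_fin_one, map_zero] at this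
  rw [Polynomial.eval_zero]
  exact this

/-- **The discriminant of an irreducible quadratic fibre is not a square.**  [folklore] -/
theorem disc_ne_sq_of_irreducible {q₀ q₁ q₂ : Polynomial ℂ} (hq₂ : q₂ ≠ 0) {P : MvPolynomial (Fin 2) ℂ}
    (hP : ∀ x y : ℂ, MvPolynomial.eval ![x, y] P = q₂.eval x * y ^ 2 + q₁.eval x * y + q₀.eval x)
    (hirr : Irreducible P) (R : Polynomial ℂ) : q₁ ^ 2 - 4 * q₂ * q₀ ≠ R ^ 2 := by
  classical
  intro hDR
  -- the swap-then-`finSuccEquiv` isomorphism singles out `y₀`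
  set φ : MvPolynomial (Fin 2) ℂ ≃ₐ[ℂ] Polynomial (MvPolynomial (Fin 1) ℂ) :=
    (MvPolynomial.renameEquiv ℂ (Equiv.swap (0 : Fin 2) 1)).trans (MvPolynomial.finSuccEquiv ℂ 1) with hφ
  have hφ0 : φ (X 0) = Polynomial.C (X 0) := by
    rw [hφ, AlgEquiv.trans_apply, MvPolynomial.renameEquiv_apply, MvPolynomial.rename_X,
      Equiv.swap_apply_left, show (1 : Fin 2) = Fin.succ 0 from rfl, MvPolynomial.finSuccEquiv_X_succ]
  have hφ1 : φ (X 1) = Polynomial.X := by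
    rw [hφ, AlgEquiv.trans_apply, MvPolynomial.renameEquiv_apply, MvPolynomial.rename_X,
      Equiv.swap_apply_right, MvPolynomial.finSuccEquiv_X_zero]
  set ι : Polynomial ℂ →ₐ[ℂ] MvPolynomial (Fin 2) ℂ := Polynomial.aeval (X 0 : MvPolynomial (Fin 2) ℂ) with hι
  set a : Polynomial ℂ → MvPolynomial (Fin 1) ℂ := fun q => Polynomial.aeval (X 0 : MvPolynomial (Fin 1) ℂ) q
    with ha
  have hφι : ∀ q : Polynomial ℂ, φ (ι q) = Polynomial.C (a q) := by
    intro q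
    rw [hι, ← Polynomial.aeval_algHom_apply, hφ0, ha]
    simp only
    rw [Polynomial.C_eq_algebraMap, Polynomial.aeval_algebraMap_apply]
    rfl
  have hφC : ∀ ε : ℂ, φ (MvPolynomial.C ε) = Polynomial.C (MvPolynomial.C ε) := by
    intro ε
    have h := φ.commutes ε
    rw [MvPolynomial.algebraMap_eq] at h
    rw [h, Polynomial.algebraMap_apply, MvPolynomial.algebraMap_eq]
  -- `P` in coordinates
  have hPAB : P = ι q₂ * X 1 ^ 2 + ι q₁ * X 1 + ι q₀ := by
    refine MvPolynomial.funext fun xs => ?_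
    have hxs : xs = ![xs 0, xs 1] := by funext i; fin_cases i <;> rfl
    rw [map_add, map_add, map_mul, map_mul, map_pow, MvPolynomial.eval_X, hι, mvEval_aeval_X, mvEval_aeval_X,
      mvEval_aeval_X]
    conv_lhs => rw [hxs, hP]
  -- the factorisation `4 q₂ P = F₋ F₊`
  set Fm : MvPolynomial (Fin 2) ℂ := 2 * ι q₂ * X 1 + ι q₁ - ι R with hFm
  set Fp : MvPolynomial (Fin 2) ℂ := 2 * ι q₂ * X 1 + ι q₁ + ι R with hFp
  have hD : ι q₁ ^ 2 - 4 * ι q₂ * ι q₀ = ι R ^ 2 := by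
    have h := congrArg ι hDR
    rw [map_sub, map_pow, map_mul, map_mul, map_ofNat, map_pow] at h
    exact h
  have hfac : 4 * ι q₂ * P = Fm * Fp := by
    rw [hPAB, hFm, hFp]
    linear_combination -hD
  -- `P` is prime and divides one of the linear factors
  have hprime : Prime P := UniqueFactorizationMonoid.irreducible_iff_prime.1 hirr
  have hdvd : P ∣ Fm * Fp := ⟨4 * ι q₂, by rw [← hfac]; ring⟩
  -- images under `φ`: `P` has `y₀`-degree 2, the factors have degree 1
  have ha₂ : a q₂ ≠ 0 := aeval_X_fin_one_ne_zero hq₂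
  have h2a₂ : a (2 * q₂) ≠ 0 := aeval_X_fin_one_ne_zero (mul_ne_zero two_ne_zero hq₂)
  have hφP : φ P = Polynomial.C (a q₂) * Polynomial.X ^ 2 + Polynomial.C (a q₁) * Polynomial.X +
      Polynomial.C (a q₀) := by
    rw [hPAB, map_add, map_add, map_mul, map_mul, map_pow, hφ1, hφι, hφι, hφι]
  have hφPdeg : (φ P).natDegree = 2 := by rw [hφP]; exact Polynomial.natDegree_quadratic ha₂
  have hlin : ∀ (ε : ℂ), (φ (2 * ι q₂ * X 1 + ι q₁ + MvPolynomial.C ε * ι R)).natDegree ≤ 1 ∧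
      φ (2 * ι q₂ * X 1 + ι q₁ + MvPolynomial.C ε * ι R) ≠ 0 := by
    intro ε
    have hform : φ (2 * ι q₂ * X 1 + ι q₁ + MvPolynomial.C ε * ι R) =
        Polynomial.C (a (2 * q₂)) * Polynomial.X + Polynomial.C (a q₁ + MvPolynomial.C ε * a R) := by
      have h2 : ι (2 * q₂) = 2 * ι q₂ := by rw [map_mul, map_ofNat]
      rw [map_add, map_add, map_mul, ← h2, hφι, hφ1, hφι, map_mul, hφι, hφC]
      simp only [map_add, map_mul]
      ring
    refine ⟨by rw [hform]; exact Polynomial.natDegree_linear_le, fun h0 => ?_⟩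
    have h1 := congrArg (fun f : Polynomial (MvPolynomial (Fin 1) ℂ) => f.coeff 1) h0
    simp only [hform, Polynomial.coeff_add, Polynomial.coeff_C_mul, Polynomial.coeff_X_one, mul_one,
      Polynomial.coeff_C_succ, add_zero, Polynomial.coeff_zero] at h1
    exact h2a₂ h1
  have hFm' : Fm = 2 * ι q₂ * X 1 + ι q₁ + MvPolynomial.C (-1) * ι R := by rw [hFm, map_neg, map_one]; ring
  have hFp' : Fp = 2 * ι q₂ * X 1 + ι q₁ + MvPolynomial.C 1 * ι R := by rw [hFp, map_one]; ring
  have hnot : ∀ F : MvPolynomial (Fin 2) ℂ, (φ F).natDegree ≤ 1 → φ F ≠ 0 → ¬ P ∣ F := by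
    intro F hF1 hF0 h
    have h' : φ P ∣ φ F := map_dvd φ h
    have := Polynomial.natDegree_le_of_dvd h' hF0
    rw [hφPdeg] at this
    omega
  rcases hprime.dvd_or_dvd hdvd with h | h
  · obtain ⟨h1, h0⟩ := hlin (-1)
    rw [← hFm'] at h1 h0
    exact hnot Fm h1 h0 h
  · obtain ⟨h1, h0⟩ := hlin 1
    rw [← hFp'] at h1 h0
    exact hnot Fp h1 h0 h

/-! ## Part C. The quadratic theorem without small print -/

/-- **EVERY irreducible quadratic fibre with simple full top row over every polynomial graph of degree
`≥ 2` is dense.**  `P = q₂(x₀)y₀² + q₁(x₀)y₀ + q₀(x₀)` irreducible, rows of degree `≤ N`, `N ≥ 1`,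
top row `[x₀^N]q₂·X² + [x₀^N]q₁·X + [x₀^N]q₀` separable with `[x₀^N]q₂ ≠ 0 ≠ [x₀^N]q₀`.
[cite: MantovaMasser2023, §1 Further remarks, p. 5 (the question, open in general)] (new) -/
theorem unprojectedDense_graph_quadraticFibre' (q₀ q₁ q₂ : Polynomial ℂ) {P : MvPolynomial (Fin 2) ℂ}
    (hP : ∀ x y : ℂ, MvPolynomial.eval ![x, y] P = q₂.eval x * y ^ 2 + q₁.eval x * y + q₀.eval x)
    (hirr : Irreducible P) (N : ℕ) (hN1 : 1 ≤ N) (hN₂ : q₂.natDegree ≤ N) (hN₁ : q₁.natDegree ≤ N)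
    (hN₀ : q₀.natDegree ≤ N) (ht₂ : q₂.coeff N ≠ 0) (ht₀ : q₀.coeff N ≠ 0)
    (hTsep : (Polynomial.C (q₂.coeff N) * Polynomial.X ^ 2 + Polynomial.C (q₁.coeff N) * Polynomial.X +
      Polynomial.C (q₀.coeff N)).Separable)
    (p : Polynomial ℂ) (hd : 2 ≤ p.natDegree) :
    UnprojectedDense {w : Fin 2 ⊕ Fin 2 → ℂ | w (Sum.inl 1) = p.eval (w (Sum.inl 0)) ∧
      MvPolynomial.eval ![w (Sum.inl 0), w (Sum.inr 0)] P = 0} := by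
  classical
  have hq₂ : q₂ ≠ 0 := fun h => ht₂ (by rw [h, Polynomial.coeff_zero])
  refine unprojectedDense_graph_quadraticFibre q₀ q₁ q₂ hP hirr N hN1 hN₂ hN₁ hN₀ ht₂ ht₀ hTsep
    (fun c hc => ?_) p hd
  -- reciprocal case: the discriminant is not a square and has degree `2N > 0`
  set D : Polynomial ℂ := q₁ ^ 2 - Polynomial.C (4 * c) * q₂ ^ 2 with hD
  have hDeq : q₁ ^ 2 - 4 * q₂ * q₀ = D := by
    rw [hD, hc, map_mul, map_ofNat]; ring
  have hne : ∀ R : Polynomial ℂ, D ≠ R ^ 2 := fun R h =>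
    disc_ne_sq_of_irreducible hq₂ hP hirr R (hDeq.trans h)
  -- degree: the `X^{2N}` coefficient of `D` is the discriminant of the top row, nonzero by separability
  have hsep0 : (q₁.coeff N) ^ 2 - 4 * c * (q₂.coeff N) ^ 2 ≠ 0 := by
    intro h0
    -- then the top row is `t₂ (X + t₁/(2t₂))²`, not squarefree
    set t₂ := q₂.coeff N with ht₂def
    set t₁ := q₁.coeff N with ht₁def
    have ht₀c : q₀.coeff N = c * t₂ := by rw [hc, Polynomial.coeff_C_mul]
    have hsq : Polynomial.C t₂ * Polynomial.X ^ 2 + Polynomial.C t₁ * Polynomial.X + Polynomial.C (q₀.coeff N) =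
        Polynomial.C t₂ * (Polynomial.X + Polynomial.C (t₁ / (2 * t₂))) ^ 2 := by
      rw [ht₀c]
      have e : c * t₂ = t₁ ^ 2 / (4 * t₂) := by
        field_simp
        linear_combination -h0
      rw [e]
      have h2 : (2 : ℂ) * t₂ ≠ 0 := mul_ne_zero two_ne_zero ht₂
      have h4 : (4 : ℂ) * t₂ ≠ 0 := mul_ne_zero (by norm_num) ht₂
      apply Polynomial.funext
      intro x
      simp only [Polynomial.eval_add, Polynomial.eval_mul, Polynomial.eval_C, Polynomial.eval_pow,
        Polynomial.eval_X]
      field_simp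
      ring
    have hsqf := hTsep.squarefree
    rw [hsq] at hsqf
    have hunit := hsqf (Polynomial.X + Polynomial.C (t₁ / (2 * t₂))) (by rw [← pow_two]; exact dvd_mul_left _ _)
    have := Polynomial.natDegree_eq_zero_of_isUnit hunit
    rw [Polynomial.natDegree_X_add_C] at this
    exact one_ne_zero this
  have hdeg : 0 < D.natDegree := by
    have hq₂N : q₂.natDegree = N := le_antisymm hN₂ (Polynomial.le_natDegree_of_ne_zero ht₂)
    have hcoef : D.coeff (2 * N) = (q₁.coeff N) ^ 2 - 4 * c * (q₂.coeff N) ^ 2 := by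
      rw [hD, Polynomial.coeff_sub, Polynomial.coeff_C_mul, two_mul, pow_two, pow_two]
      rw [Polynomial.coeff_mul_add_eq_of_natDegree_le hN₁ hN₁,
        Polynomial.coeff_mul_add_eq_of_natDegree_le hN₂ hN₂]
      ring
    have h2N : 2 * N ≤ D.natDegree := Polynomial.le_natDegree_of_ne_zero (by rw [hcoef]; exact hsep0)
    omega
  exact exists_odd_rootMultiplicity_of_ne_sq hdeg hne

end Summit.Schanuel.Schanuel.Theorems
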